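import Summits.CriticalPhenomena.PercolationContinuityZ3.Theorems.PercNearOneGluingNoHeavyLowerTailKernelRowsGZ
import HarnessLib

/-!
# Kernel rows, Gladkov–Zimin cone form — POLARIZED along a monotone pair of product measures

Support file for crux `stmt-CriticalPhenomena-4575` (`NoHeavyLowerTail`), E3GRP-by-switching line, strategy 3
(seat `prim-e3grp-switch-3` gen 2); companion of `…KernelRowsGZ.lean` (`KernelRows.prodBernoulli_gzRow`, the
diagonal case).  Everything here is PROVED; it is a NEW result of this programme, not a published statement.

**Theorem (`KernelRows.prodBernoulli_gzRow_polarized`).**  `μ = prodBernoulli p`, `ν = prodBernoulli p'` on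
`Set ι` (`ι` finite) with `p' ≤ p` coordinatewise; `Q` a finite preorder; `λ, λ' : Set ι → Q` monotone with the
cross-condition `ω' ⊆ ω → λ' ω' ≤ λ ω` (for `λ' = λ` this is monotonicity); `m x = μ(λ = x)`,
`m' x = ν(λ' = x)`; `κ : Q → Q → ℝ` ANY kernel submodular on comparable rectangles.  Then
`Σ_x κ(x,x) (m x + m' x) ≤ Σ_{x,y} κ(x,y) (m x m' y + m' x m y)`.
With `A = −κ` (cover-supermodular) and the polarized Gladkov–Zimin matrix
`Q(m,m') = ½(diag m + diag m') − ½(m m'ᵀ + m' mᵀ)` this reads `⟨A, Q(m,m')⟩ ≥ 0`: EVERY row of the GZ cone of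
quadratic inequalities (Harris, Aas–Gladkov, lattice strong-HK, …, run/shared/lean/ttrl/gz/README.md §0) holds in
POLARIZED form `Σ_{a<b} D_ab (m_a m'_b + m_b m'_a) ≥ 0` for two COMPARABLE realizable laws (same graph, edge
weights `w' ≤ w`, or vertex/edge deletions).  For incomparable laws it fails (polarized Aas–Gladkov: 211 of 700
random pairs; memo prim-e3grp-switch-3/FINDINGS-switch3-g2.md).  Equivalently: `Q(m,m') = F M Fᵀ` with `M ≥ 0`
entrywise (`F` = cover matrix), the polarized form of the GZ primal statement.

Proof: the induction of the companion files run for PAIRS `(λ, μ), (λ', ν)`.  Exposing a coordinate `e` with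
weights `t = p_e ≥ t' = p'_e`, the defect is bi-affine in `(t, t')` and equals
`(1 − t) Φ₀₀ + t' Φ₁₁ + (t − t') Φ₁₀ + (1 − t) t' G` where `Φ_{αβ}` are the defects of the section pairs (the
cross-condition passes to the pairs (upper,upper), (lower,lower), (upper,lower)) and
`G = −[qform κ Δ Δ' + qform κ Δ' Δ] ≥ 0` for the two one-coordinate increments `Δ, Δ'` — the two-system form of
the transition lemma (`qform_transition_nonpos₂`: `Σ τ(u,v) τ'(u',v') [κ(v,v') − κ(v,u') − κ(u,v') + κ(u,u')] ≤ 0`).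
The base case (`F = ∅`: point masses at `λ ∅ ≥ λ' ∅`) is where comparability enters.
-/

noncomputable section

namespace Summit.CriticalPhenomena.PercolationContinuityZ3.Theorems

namespace KernelRows

open MeasureTheory Finset Literature.Probability.LatticeModels Literature.Probability.Percolation
open Literature.Probability.LatticeModels.StrongHarris

variable {ι : Type*} {Q : Type*} [Fintype Q] (κ : Q → Q → ℝ)

/-- **Two-system transition lemma.**  If `Δ(x) = Σ_u τ(u,x) − Σ_v τ(x,v)` and `Δ'(x) = Σ_u τ'(u,x) − Σ_v τ'(x,v)`
with `τ, τ' ≥ 0` supported on comparable pairs `u ≤ v`, and `κ` is submodular on comparable rectangles, then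
`qform κ Δ Δ' ≤ 0`. [this work; the case `τ' = τ` is `qform_transition_nonpos`] -/
theorem qform_transition_nonpos₂ [DecidableEq Q] [Preorder Q]
    (hsub : ∀ a₀ a₁ b₀ b₁ : Q, a₀ ≤ a₁ → b₀ ≤ b₁ → κ a₁ b₁ + κ a₀ b₀ ≤ κ a₁ b₀ + κ a₀ b₁)
    (τ τ' : Q → Q → ℝ) (hτ : ∀ u v, 0 ≤ τ u v) (hτle : ∀ u v, τ u v ≠ 0 → u ≤ v)
    (hτ' : ∀ u v, 0 ≤ τ' u v) (hτle' : ∀ u v, τ' u v ≠ 0 → u ≤ v) :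
    qform κ (fun x => ∑ u, τ u x - ∑ v, τ x v) (fun x => ∑ u, τ' u x - ∑ v, τ' x v) ≤ 0 := by
  -- rewrite `Δ`, `Δ'` as combinations of transitions
  have hΔ : ∀ σ : Q → Q → ℝ, (fun x => ∑ u, σ u x - ∑ v, σ x v) =
      fun x => ∑ u, ∑ v, σ u v * ((Pi.single v (1 : ℝ) : Q → ℝ) x - (Pi.single u (1 : ℝ) : Q → ℝ) x) := by
    intro σ
    ext x
    have h1 : ∑ u, ∑ v, σ u v * (Pi.single v (1 : ℝ) : Q → ℝ) x = ∑ u, σ u x := by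
      refine sum_congr rfl fun u _ => ?_
      simp only [Pi.single_apply, mul_ite, mul_one, mul_zero, sum_ite_eq, mem_univ, if_true]
    have h2 : ∑ u, ∑ v, σ u v * (Pi.single u (1 : ℝ) : Q → ℝ) x = ∑ v, σ x v := by
      rw [sum_comm]
      refine sum_congr rfl fun v _ => ?_
      simp only [Pi.single_apply, mul_ite, mul_one, mul_zero, sum_ite_eq, mem_univ, if_true]
    simp only [mul_sub, sum_sub_distrib]
    rw [h1, h2]
  rw [hΔ τ, hΔ τ']
  have step1 : qform κ
      (fun x => ∑ u, ∑ v, τ u v * ((Pi.single v (1 : ℝ) : Q → ℝ) x - (Pi.single u (1 : ℝ) : Q → ℝ) x))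
      (fun x => ∑ u, ∑ v, τ' u v * ((Pi.single v (1 : ℝ) : Q → ℝ) x - (Pi.single u (1 : ℝ) : Q → ℝ) x)) =
      ∑ u, ∑ v, ∑ u', ∑ v', τ u v * τ' u' v' *
        (κ v v' - κ v u' - κ u v' + κ u u') := by
    rw [qform_sum_left]
    refine sum_congr rfl fun u _ => ?_
    rw [qform_sum_left]
    refine sum_congr rfl fun v _ => ?_
    have : (fun x => τ u v * ((Pi.single v (1 : ℝ) : Q → ℝ) x - (Pi.single u (1 : ℝ) : Q → ℝ) x)) =
        τ u v • ((Pi.single v (1 : ℝ) : Q → ℝ) - Pi.single u 1) := by ext x; simp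
    rw [this, qform_smul_left, qform_sum_right, mul_sum]
    refine sum_congr rfl fun u' _ => ?_
    rw [qform_sum_right, mul_sum]
    refine sum_congr rfl fun v' _ => ?_
    have : (fun x => τ' u' v' * ((Pi.single v' (1 : ℝ) : Q → ℝ) x - (Pi.single u' (1 : ℝ) : Q → ℝ) x)) =
        τ' u' v' • ((Pi.single v' (1 : ℝ) : Q → ℝ) - Pi.single u' 1) := by ext x; simp
    rw [this, qform_smul_right, qform_transition]
    ring
  rw [step1]
  refine sum_nonpos fun u _ => sum_nonpos fun v _ => sum_nonpos fun u' _ => sum_nonpos fun v' _ => ?_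
  by_cases h1 : τ u v = 0
  · simp [h1]
  by_cases h2 : τ' u' v' = 0
  · simp [h2]
  have hs := hsub u v u' v' (hτle u v h1) (hτle' u' v' h2)
  have hnn : 0 ≤ τ u v * τ' u' v' := mul_nonneg (hτ u v) (hτ' u' v')
  have : κ v v' - κ v u' - κ u v' + κ u u' ≤ 0 := by linarith
  exact mul_nonpos_of_nonneg_of_nonpos hnn this

/-- **Transition data of one monotone statistic along one coordinate** (the bookkeeping of
`prodBernoulli_gzRow_of_determinedBy`, isolated): with `λ¹ ω = λ(insert e ω)`, `λ⁰ ω = λ(ω ∖ {e})`,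
`m¹, m⁰` their fibre masses under `prodBernoulli p`, there is `τ ≥ 0` supported on comparable pairs with
`m¹ − m⁰ = (x ↦ Σ_u τ(u,x) − Σ_v τ(x,v))`, and `μ(λ = x) = m⁰ x + p_e (m¹ x − m⁰ x)`. [this work] -/
theorem sectionTransition [DecidableEq ι] [DecidableEq Q] [Preorder Q] (p : ι → unitInterval) (e : ι)
    (F' : Finset ι) (lam : Set ι → Q) (hmono : ∀ ⦃ω ω' : Set ι⦄, ω ⊆ ω' → lam ω ≤ lam ω')
    (hdet : ∀ q, DeterminedBy (lam ⁻¹' {q}) (↑(insert e F') : Set ι)) :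
    ∃ τ : Q → Q → ℝ, (∀ u v, 0 ≤ τ u v) ∧ (∀ u v, τ u v ≠ 0 → u ≤ v) ∧
      ((fun x => (prodBernoulli p).real ((fun ω => lam (insert e ω)) ⁻¹' {x})) -
          (fun x => (prodBernoulli p).real ((fun ω => lam (ω \ {e})) ⁻¹' {x})) =
        fun x => ∑ u, τ u x - ∑ v, τ x v) ∧
      (∀ x, (prodBernoulli p).real (lam ⁻¹' {x}) =
        (prodBernoulli p).real ((fun ω => lam (ω \ {e})) ⁻¹' {x}) +
          (p e : ℝ) * ((prodBernoulli p).real ((fun ω => lam (insert e ω)) ⁻¹' {x}) -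
            (prodBernoulli p).real ((fun ω => lam (ω \ {e})) ⁻¹' {x}))) := by
  set μ := prodBernoulli p with hμ
  set lam1 : Set ι → Q := fun ω => lam (insert e ω) with hlam1
  set lam0 : Set ι → Q := fun ω => lam (ω \ {e}) with hlam0
  have hdet1 : ∀ q, DeterminedBy (lam1 ⁻¹' {q}) (↑F' : Set ι) :=
    fun q => determinedBy_preimage_insert (hdet q)
  have hdet0 : ∀ q, DeterminedBy (lam0 ⁻¹' {q}) (↑F' : Set ι) :=
    fun q => determinedBy_preimage_sdiff (hdet q)
  set m1 : Q → ℝ := fun x => μ.real (lam1 ⁻¹' {x}) with hm1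
  set m0 : Q → ℝ := fun x => μ.real (lam0 ⁻¹' {x}) with hm0
  have hdecx : ∀ x, μ.real (lam ⁻¹' {x}) = m0 x + (p e : ℝ) * (m1 x - m0 x) := by
    intro x
    have := real_eq_preimage_insert_add_preimage_sdiff p e (hdet x)
    simp only [hm0, hm1, hlam0, hlam1]
    rw [hμ] at *
    rw [this]
    simp only [Set.preimage_preimage]
    ring
  set τ : Q → Q → ℝ := fun u v => μ.real (lam0 ⁻¹' {u} ∩ lam1 ⁻¹' {v}) with hτ
  have hmeas : ∀ u v, MeasurableSet (lam0 ⁻¹' {u} ∩ lam1 ⁻¹' {v}) := fun u v =>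
    ((hdet0 u).measurableSet_of_finset).inter ((hdet1 v).measurableSet_of_finset)
  have hτnn : ∀ u v, 0 ≤ τ u v := fun u v => measureReal_nonneg
  have hτle : ∀ u v, τ u v ≠ 0 → u ≤ v := by
    intro u v hne
    by_contra hle
    apply hne
    have : lam0 ⁻¹' {u} ∩ lam1 ⁻¹' {v} = ∅ := by
      ext ω
      simp only [Set.mem_inter_iff, Set.mem_preimage, Set.mem_singleton_iff,
        Set.mem_empty_iff_false, iff_false, not_and]
      intro hu hv
      apply hle
      rw [← hu, ← hv]
      exact hmono fun x hx => Set.mem_insert_of_mem _ hx.1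
    simp [hτ, this]
  set pr : Set ι → Q × Q := fun ω => (lam0 ω, lam1 ω) with hpr
  have hfib : ∀ z : Q × Q, pr ⁻¹' {z} = lam0 ⁻¹' {z.1} ∩ lam1 ⁻¹' {z.2} := by
    intro z; ext ω; simp [hpr, Prod.ext_iff]
  have hm0sum : ∀ u, m0 u = ∑ v, τ u v := by
    intro u
    have hs := sum_measureReal_preimage_singleton (μ := μ) ({u} ×ˢ (univ : Finset Q))
      (f := pr) (fun z _ => by rw [hfib]; exact hmeas _ _)
    rw [sum_product] at hs
    simp only [sum_singleton] at hs
    have e1 : pr ⁻¹' (↑({u} ×ˢ (univ : Finset Q)) : Set (Q × Q)) = lam0 ⁻¹' {u} := by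
      ext ω; simp [hpr, eq_comm]
    rw [e1] at hs
    rw [hm0]
    simp only
    rw [← hs]
    exact sum_congr rfl fun v _ => by rw [hfib]
  have hm1sum : ∀ v, m1 v = ∑ u, τ u v := by
    intro v
    have hs := sum_measureReal_preimage_singleton (μ := μ) ((univ : Finset Q) ×ˢ {v})
      (f := pr) (fun z _ => by rw [hfib]; exact hmeas _ _)
    rw [sum_product] at hs
    simp only [sum_singleton] at hs
    have e1 : pr ⁻¹' (↑((univ : Finset Q) ×ˢ {v}) : Set (Q × Q)) = lam1 ⁻¹' {v} := by
      ext ω; simp [hpr, eq_comm]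
    rw [e1] at hs
    rw [hm1]
    simp only
    rw [← hs]
    exact sum_congr rfl fun u _ => by rw [hfib]
  refine ⟨τ, hτnn, hτle, ?_, hdecx⟩
  ext x; simp only [Pi.sub_apply]; rw [hm1sum, hm0sum]

/-- **Polarized Gladkov–Zimin cone rows for cylinder statistics.**  For `μ = prodBernoulli p`,
`ν = prodBernoulli p'` with `p' ≤ p`, monotone statistics `λ, λ' : Set ι → Q` (finite preorder `Q`) with fibres
determined by the finite set `F` and the cross-condition `ω' ⊆ ω → λ' ω' ≤ λ ω`, and ANY kernel `κ` submodular
on comparable rectangles: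
`Σ_x κ(x,x) (μ(λ=x) + ν(λ'=x)) ≤ Σ_{x,y} κ(x,y) (μ(λ=x) ν(λ'=y) + ν(λ'=x) μ(λ=y))`. [this work] -/
theorem prodBernoulli_gzRow_polarized_of_determinedBy [DecidableEq Q] [Preorder Q] (p p' : ι → unitInterval)
    (hpp : ∀ e, (p' e : ℝ) ≤ p e)
    (hsub : ∀ a₀ a₁ b₀ b₁ : Q, a₀ ≤ a₁ → b₀ ≤ b₁ → κ a₁ b₁ + κ a₀ b₀ ≤ κ a₁ b₀ + κ a₀ b₁)
    (F : Finset ι) :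
    ∀ lam lam' : Set ι → Q, (∀ ⦃ω ω' : Set ι⦄, ω ⊆ ω' → lam ω ≤ lam ω') →
      (∀ ⦃ω ω' : Set ι⦄, ω ⊆ ω' → lam' ω ≤ lam' ω') →
      (∀ ω ω' : Set ι, ω' ⊆ ω → lam' ω' ≤ lam ω) →
      (∀ q, DeterminedBy (lam ⁻¹' {q}) (↑F : Set ι)) → (∀ q, DeterminedBy (lam' ⁻¹' {q}) (↑F : Set ι)) →
      ∑ x, κ x x * ((prodBernoulli p).real (lam ⁻¹' {x}) + (prodBernoulli p').real (lam' ⁻¹' {x})) ≤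
        qform κ (fun x => (prodBernoulli p).real (lam ⁻¹' {x}))
            (fun x => (prodBernoulli p').real (lam' ⁻¹' {x})) +
          qform κ (fun x => (prodBernoulli p').real (lam' ⁻¹' {x}))
            (fun x => (prodBernoulli p).real (lam ⁻¹' {x})) := by
  classical
  induction F using Finset.induction_on with
  | empty =>
    intro lam lam' _ _ hX hdet hdet'
    have hconst : ∀ ω, lam ω = lam ∅ := by
      intro ω
      have h := (determinedBy_iff _ _).1 (hdet (lam ∅)) ∅ ω (by simp)
      simpa using h
    have hconst' : ∀ ω, lam' ω = lam' ∅ := by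
      intro ω
      have h := (determinedBy_iff _ _).1 (hdet' (lam' ∅)) ∅ ω (by simp)
      simpa using h
    have hm : (fun x => (prodBernoulli p).real (lam ⁻¹' {x})) = Pi.single (lam ∅) (1 : ℝ) := by
      ext x
      by_cases hx : x = lam ∅
      · subst hx
        have : lam ⁻¹' {lam ∅} = Set.univ := by
          ext ω; simp [hconst ω]
        rw [this]; simp
      · have : lam ⁻¹' {x} = ∅ := by
          ext ω; simp only [Set.mem_preimage, Set.mem_singleton_iff, Set.mem_empty_iff_false,
            iff_false]; rw [hconst ω]; exact Ne.symm hx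
        rw [this]; simp [hx]
    have hm' : (fun x => (prodBernoulli p').real (lam' ⁻¹' {x})) = Pi.single (lam' ∅) (1 : ℝ) := by
      ext x
      by_cases hx : x = lam' ∅
      · subst hx
        have : lam' ⁻¹' {lam' ∅} = Set.univ := by
          ext ω; simp [hconst' ω]
        rw [this]; simp
      · have : lam' ⁻¹' {x} = ∅ := by
          ext ω; simp only [Set.mem_preimage, Set.mem_singleton_iff, Set.mem_empty_iff_false,
            iff_false]; rw [hconst' ω]; exact Ne.symm hx
        rw [this]; simp [hx]
    have hlin : ∑ x, κ x x * ((prodBernoulli p).real (lam ⁻¹' {x}) + (prodBernoulli p').real (lam' ⁻¹' {x})) =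
        κ (lam ∅) (lam ∅) + κ (lam' ∅) (lam' ∅) := by
      have : ∀ x, κ x x * ((prodBernoulli p).real (lam ⁻¹' {x}) + (prodBernoulli p').real (lam' ⁻¹' {x})) =
          κ x x * (Pi.single (lam ∅) (1 : ℝ) : Q → ℝ) x + κ x x * (Pi.single (lam' ∅) (1 : ℝ) : Q → ℝ) x :=
        fun x => by rw [← hm, ← hm']; ring
      simp_rw [this]
      rw [sum_add_distrib]
      simp [Pi.single_apply]
    rw [hlin, hm, hm', qform_single, qform_single]
    have hle : lam' ∅ ≤ lam ∅ := hX ∅ ∅ le_rfl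
    have := hsub (lam' ∅) (lam ∅) (lam' ∅) (lam ∅) hle hle
    linarith
  | insert e F' he ih =>
    intro lam lam' hmono hmono' hX hdet hdet'
    -- the four section statistics
    have hmono1 : ∀ ⦃ω ω' : Set ι⦄, ω ⊆ ω' → (fun ω => lam (insert e ω)) ω ≤ (fun ω => lam (insert e ω)) ω' :=
      fun ω ω' h => hmono (Set.insert_subset_insert h)
    have hmono0 : ∀ ⦃ω ω' : Set ι⦄, ω ⊆ ω' → (fun ω => lam (ω \ {e})) ω ≤ (fun ω => lam (ω \ {e})) ω' :=
      fun ω ω' h => hmono fun x hx => ⟨h hx.1, hx.2⟩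
    have hmono1' : ∀ ⦃ω ω' : Set ι⦄, ω ⊆ ω' → (fun ω => lam' (insert e ω)) ω ≤ (fun ω => lam' (insert e ω)) ω' :=
      fun ω ω' h => hmono' (Set.insert_subset_insert h)
    have hmono0' : ∀ ⦃ω ω' : Set ι⦄, ω ⊆ ω' → (fun ω => lam' (ω \ {e})) ω ≤ (fun ω => lam' (ω \ {e})) ω' :=
      fun ω ω' h => hmono' fun x hx => ⟨h hx.1, hx.2⟩
    have hdet1 : ∀ q, DeterminedBy ((fun ω => lam (insert e ω)) ⁻¹' {q}) (↑F' : Set ι) :=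
      fun q => determinedBy_preimage_insert (hdet q)
    have hdet0 : ∀ q, DeterminedBy ((fun ω => lam (ω \ {e})) ⁻¹' {q}) (↑F' : Set ι) :=
      fun q => determinedBy_preimage_sdiff (hdet q)
    have hdet1' : ∀ q, DeterminedBy ((fun ω => lam' (insert e ω)) ⁻¹' {q}) (↑F' : Set ι) :=
      fun q => determinedBy_preimage_insert (hdet' q)
    have hdet0' : ∀ q, DeterminedBy ((fun ω => lam' (ω \ {e})) ⁻¹' {q}) (↑F' : Set ι) :=
      fun q => determinedBy_preimage_sdiff (hdet' q)
    -- cross-conditions of the three section pairs (upper,upper), (lower,lower), (upper,lower)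
    have hX11 : ∀ ω ω' : Set ι, ω' ⊆ ω → (fun ω => lam' (insert e ω)) ω' ≤ (fun ω => lam (insert e ω)) ω :=
      fun ω ω' h => hX _ _ (Set.insert_subset_insert h)
    have hX00 : ∀ ω ω' : Set ι, ω' ⊆ ω → (fun ω => lam' (ω \ {e})) ω' ≤ (fun ω => lam (ω \ {e})) ω :=
      fun ω ω' h => hX _ _ (fun x hx => ⟨h hx.1, hx.2⟩)
    have hX10 : ∀ ω ω' : Set ι, ω' ⊆ ω → (fun ω => lam' (ω \ {e})) ω' ≤ (fun ω => lam (insert e ω)) ω :=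
      fun ω ω' h => hX _ _ (fun x hx => Set.mem_insert_of_mem _ (h hx.1))
    -- the three induction hypotheses
    have ih00 := ih _ _ hmono0 hmono0' hX00 hdet0 hdet0'
    have ih11 := ih _ _ hmono1 hmono1' hX11 hdet1 hdet1'
    have ih10 := ih _ _ hmono1 hmono0' hX10 hdet1 hdet0'
    -- transition data and one-coordinate decompositions of the two statistics
    obtain ⟨τ, hτnn, hτle, hΔ, hdecx⟩ := sectionTransition p e F' lam hmono hdet
    obtain ⟨τ', hτnn', hτle', hΔ', hdecx'⟩ := sectionTransition p' e F' lam' hmono' hdet'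
    -- names for the four fibre-mass functions
    set m1 : Q → ℝ := fun x => (prodBernoulli p).real ((fun ω => lam (insert e ω)) ⁻¹' {x}) with hm1
    set m0 : Q → ℝ := fun x => (prodBernoulli p).real ((fun ω => lam (ω \ {e})) ⁻¹' {x}) with hm0
    set m1' : Q → ℝ := fun x => (prodBernoulli p').real ((fun ω => lam' (insert e ω)) ⁻¹' {x}) with hm1'
    set m0' : Q → ℝ := fun x => (prodBernoulli p').real ((fun ω => lam' (ω \ {e})) ⁻¹' {x}) with hm0'
    set t : ℝ := (p e : ℝ) with ht
    set t' : ℝ := (p' e : ℝ) with ht'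
    have ht1 : t ≤ 1 := (p e).2.2
    have ht0' : 0 ≤ t' := (p' e).2.1
    have htt : t' ≤ t := hpp e
    have r1 : ∀ x, (prodBernoulli p).real ((fun ω => lam (insert e ω)) ⁻¹' {x}) = m1 x := fun x => rfl
    have r0 : ∀ x, (prodBernoulli p).real ((fun ω => lam (ω \ {e})) ⁻¹' {x}) = m0 x := fun x => rfl
    have r1' : ∀ x, (prodBernoulli p').real ((fun ω => lam' (insert e ω)) ⁻¹' {x}) = m1' x := fun x => rfl
    have r0' : ∀ x, (prodBernoulli p').real ((fun ω => lam' (ω \ {e})) ⁻¹' {x}) = m0' x := fun x => rfl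
    have hdec : (fun x => (prodBernoulli p).real (lam ⁻¹' {x})) = m0 + t • (m1 - m0) := by
      ext x; rw [hdecx x, r0 x, r1 x]; simp
    have hdec' : (fun x => (prodBernoulli p').real (lam' ⁻¹' {x})) = m0' + t' • (m1' - m0') := by
      ext x; rw [hdecx' x, r0' x, r1' x]; simp
    -- the mixed second differences are nonpositive
    have hG1 : qform κ (m1 - m0) (m1' - m0') ≤ 0 := by
      rw [hΔ, hΔ']; exact qform_transition_nonpos₂ κ hsub τ τ' hτnn hτle hτnn' hτle'
    have hG2 : qform κ (m1' - m0') (m1 - m0) ≤ 0 := by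
      rw [hΔ, hΔ']; exact qform_transition_nonpos₂ κ hsub τ' τ hτnn' hτle' hτnn hτle
    -- linear terms
    have hlin : ∑ x, κ x x * ((prodBernoulli p).real (lam ⁻¹' {x}) + (prodBernoulli p').real (lam' ⁻¹' {x})) =
        (∑ x, κ x x * m0 x) + t * (∑ x, κ x x * (m1 x - m0 x)) + (∑ x, κ x x * m0' x) +
          t' * (∑ x, κ x x * (m1' x - m0' x)) := by
      have e1 : ∀ x, κ x x * ((prodBernoulli p).real (lam ⁻¹' {x}) + (prodBernoulli p').real (lam' ⁻¹' {x})) =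
          κ x x * m0 x + t * (κ x x * (m1 x - m0 x)) + κ x x * m0' x + t' * (κ x x * (m1' x - m0' x)) := by
        intro x; rw [hdecx x, hdecx' x, r0 x, r1 x, r0' x, r1' x]; ring
      simp_rw [e1]
      rw [sum_add_distrib, sum_add_distrib, sum_add_distrib, ← mul_sum, ← mul_sum]
    have hlin00 : ∑ x, κ x x * ((prodBernoulli p).real ((fun ω => lam (ω \ {e})) ⁻¹' {x}) +
        (prodBernoulli p').real ((fun ω => lam' (ω \ {e})) ⁻¹' {x})) =
        (∑ x, κ x x * m0 x) + ∑ x, κ x x * m0' x := by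
      rw [← sum_add_distrib]; exact sum_congr rfl fun x _ => by rw [r0 x, r0' x]; ring
    have hlin11 : ∑ x, κ x x * ((prodBernoulli p).real ((fun ω => lam (insert e ω)) ⁻¹' {x}) +
        (prodBernoulli p').real ((fun ω => lam' (insert e ω)) ⁻¹' {x})) =
        (∑ x, κ x x * m0 x) + (∑ x, κ x x * (m1 x - m0 x)) + ((∑ x, κ x x * m0' x) +
          ∑ x, κ x x * (m1' x - m0' x)) := by
      rw [← sum_add_distrib, ← sum_add_distrib, ← sum_add_distrib]
      exact sum_congr rfl fun x _ => by rw [r1 x, r1' x]; ring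
    have hlin10 : ∑ x, κ x x * ((prodBernoulli p).real ((fun ω => lam (insert e ω)) ⁻¹' {x}) +
        (prodBernoulli p').real ((fun ω => lam' (ω \ {e})) ⁻¹' {x})) =
        (∑ x, κ x x * m0 x) + (∑ x, κ x x * (m1 x - m0 x)) + ∑ x, κ x x * m0' x := by
      rw [← sum_add_distrib, ← sum_add_distrib]
      exact sum_congr rfl fun x _ => by rw [r1 x, r0' x]; ring
    -- quadratic terms: expand the section masses `m1 = m0 + (m1 - m0)` bilinearly
    have hm1e : m1 = m0 + (m1 - m0) := by abel
    have hm1e' : m1' = m0' + (m1' - m0') := by abel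
    have q11 : qform κ m1 m1' + qform κ m1' m1 =
        qform κ m0 m0' + qform κ m0 (m1' - m0') + qform κ (m1 - m0) m0' + qform κ (m1 - m0) (m1' - m0') +
          (qform κ m0' m0 + qform κ m0' (m1 - m0) + qform κ (m1' - m0') m0 +
            qform κ (m1' - m0') (m1 - m0)) := by
      conv_lhs => rw [hm1e, hm1e']
      simp only [qform_add_left, qform_add_right]
      ring
    have q10 : qform κ m1 m0' + qform κ m0' m1 =
        qform κ m0 m0' + qform κ (m1 - m0) m0' + (qform κ m0' m0 + qform κ m0' (m1 - m0)) := by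
      conv_lhs => rw [hm1e]
      simp only [qform_add_left, qform_add_right]
    -- the induction hypotheses in these terms
    have i00 : (∑ x, κ x x * m0 x) + ∑ x, κ x x * m0' x ≤ qform κ m0 m0' + qform κ m0' m0 := by
      rw [← hlin00]; exact ih00
    have i11 : (∑ x, κ x x * m0 x) + (∑ x, κ x x * (m1 x - m0 x)) + ((∑ x, κ x x * m0' x) +
          ∑ x, κ x x * (m1' x - m0' x)) ≤ qform κ m1 m1' + qform κ m1' m1 := by
      rw [← hlin11]; exact ih11
    have i10 : (∑ x, κ x x * m0 x) + (∑ x, κ x x * (m1 x - m0 x)) + ∑ x, κ x x * m0' x ≤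
        qform κ m1 m0' + qform κ m0' m1 := by
      rw [← hlin10]; exact ih10
    rw [q11] at i11
    rw [q10] at i10
    -- assemble: defect = (1-t) Φ₀₀ + t' Φ₁₁ + (t-t') Φ₁₀ + (1-t) t' G
    rw [hlin, hdec, hdec']
    simp only [qform_add_left, qform_add_right, qform_smul_left, qform_smul_right]
    have a00 := mul_le_mul_of_nonneg_left i00 (by linarith : (0:ℝ) ≤ 1 - t)
    have a11 := mul_le_mul_of_nonneg_left i11 ht0'
    have a10 := mul_le_mul_of_nonneg_left i10 (by linarith : (0:ℝ) ≤ t - t')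
    have aG : 0 ≤ (1 - t) * t' * (-(qform κ (m1 - m0) (m1' - m0') + qform κ (m1' - m0') (m1 - m0))) :=
      mul_nonneg (mul_nonneg (by linarith) ht0') (by linarith)
    nlinarith [a00, a11, a10, aG]

/-- **Polarized Gladkov–Zimin cone rows, finite index type.**  For `μ = prodBernoulli p`, `ν = prodBernoulli p'`
(`ι` finite, `p' ≤ p`), monotone statistics `λ, λ'` into a finite preorder with `ω' ⊆ ω → λ' ω' ≤ λ ω`, and any
kernel `κ` submodular on comparable rectangles:
`Σ_x κ(x,x) (μ(λ=x) + ν(λ'=x)) ≤ Σ_{x,y} κ(x,y) (μ(λ=x) ν(λ'=y) + ν(λ'=x) μ(λ=y))`.  For `λ' = λ` (cross-condition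
= monotonicity) and the partition-into-open-clusters statistic these are the GZ-cone rows of the wf3lp/gz lanes,
now for two comparable edge-weight vectors. [this work] -/
theorem prodBernoulli_gzRow_polarized [Finite ι] [DecidableEq Q] [Preorder Q] (p p' : ι → unitInterval)
    (hpp : ∀ e, (p' e : ℝ) ≤ p e)
    (hsub : ∀ a₀ a₁ b₀ b₁ : Q, a₀ ≤ a₁ → b₀ ≤ b₁ → κ a₁ b₁ + κ a₀ b₀ ≤ κ a₁ b₀ + κ a₀ b₁)
    (lam lam' : Set ι → Q) (hmono : ∀ ⦃ω ω' : Set ι⦄, ω ⊆ ω' → lam ω ≤ lam ω')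
    (hmono' : ∀ ⦃ω ω' : Set ι⦄, ω ⊆ ω' → lam' ω ≤ lam' ω')
    (hX : ∀ ω ω' : Set ι, ω' ⊆ ω → lam' ω' ≤ lam ω) :
    ∑ x, κ x x * ((prodBernoulli p).real (lam ⁻¹' {x}) + (prodBernoulli p').real (lam' ⁻¹' {x})) ≤
      ∑ x, ∑ y, κ x y * ((prodBernoulli p).real (lam ⁻¹' {x}) * (prodBernoulli p').real (lam' ⁻¹' {y}) +
        (prodBernoulli p').real (lam' ⁻¹' {x}) * (prodBernoulli p).real (lam ⁻¹' {y})) := by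
  classical
  haveI := Fintype.ofFinite ι
  have hall : ∀ X : Set (Set ι), DeterminedBy X (↑(Finset.univ : Finset ι) : Set ι) := fun X => by
    rw [determinedBy_iff]; intro ω ω' h; simp only [Finset.coe_univ, Set.inter_univ] at h; rw [h]
  have key := prodBernoulli_gzRow_polarized_of_determinedBy κ p p' hpp hsub Finset.univ lam lam' hmono hmono'
    hX (fun q => hall _) (fun q => hall _)
  have e : qform κ (fun x => (prodBernoulli p).real (lam ⁻¹' {x})) (fun x => (prodBernoulli p').real (lam' ⁻¹' {x})) +
      qform κ (fun x => (prodBernoulli p').real (lam' ⁻¹' {x})) (fun x => (prodBernoulli p).real (lam ⁻¹' {x})) =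
      ∑ x, ∑ y, κ x y * ((prodBernoulli p).real (lam ⁻¹' {x}) * (prodBernoulli p').real (lam' ⁻¹' {y}) +
        (prodBernoulli p').real (lam' ⁻¹' {x}) * (prodBernoulli p).real (lam ⁻¹' {y})) := by
    simp only [qform, ← sum_add_distrib, ← mul_add]
  rw [← e]; exact key

/-- The same for ONE monotone statistic (`λ' = λ`: the cross-condition is monotonicity). [this work] -/
theorem prodBernoulli_gzRow_polarized_self [Finite ι] [DecidableEq Q] [Preorder Q] (p p' : ι → unitInterval)
    (hpp : ∀ e, (p' e : ℝ) ≤ p e)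
    (hsub : ∀ a₀ a₁ b₀ b₁ : Q, a₀ ≤ a₁ → b₀ ≤ b₁ → κ a₁ b₁ + κ a₀ b₀ ≤ κ a₁ b₀ + κ a₀ b₁)
    (lam : Set ι → Q) (hmono : ∀ ⦃ω ω' : Set ι⦄, ω ⊆ ω' → lam ω ≤ lam ω') :
    ∑ x, κ x x * ((prodBernoulli p).real (lam ⁻¹' {x}) + (prodBernoulli p').real (lam ⁻¹' {x})) ≤
      ∑ x, ∑ y, κ x y * ((prodBernoulli p).real (lam ⁻¹' {x}) * (prodBernoulli p').real (lam ⁻¹' {y}) +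
        (prodBernoulli p').real (lam ⁻¹' {x}) * (prodBernoulli p).real (lam ⁻¹' {y})) :=
  prodBernoulli_gzRow_polarized κ p p' hpp hsub lam lam hmono hmono fun _ _ h => hmono h

end KernelRows

end Summit.CriticalPhenomena.PercolationContinuityZ3.Theorems

end
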